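import Literature.Algebra.Polynomial.CasasAlvero.DigitCriterion
import HarnessLib

/-!
# The top digit is never a Casas-Alvero degree: `¬ CA_{(p-1)·p^k}` in every characteristic `p ≥ 5`

`binom(p-1, 2) = (p-1)(p-2)/2 ≡ (-1)(-2)/2 = 1 (mod p)`, so by the binomial criterion (`DigitCriterion.lean`) the polynomial
`X^(p-1) - X^2` is a Casas-Alvero polynomial of degree `p - 1` over every field of characteristic `p ≥ 5` which is not a pure
power; hence the leading base-`p` digit `p - 1` is excluded in every characteristic `p ≥ 5` (for `p = 5, 7, 11, 13` these are the
entries `4`, `6`, `10`, `12` of the classification files).  In characteristic `3` the top digit `2` IS Casas-Alvero (`2·3^k`,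
[GrafVonBothmerEtAl2007, Prop. 6]) and in characteristic `2` the only non-zero digit `1` is.
-/

namespace Literature.Algebra.Polynomial.CasasAlvero

/-- `binom(p-1, 2) ≡ 1 (mod p)` for every prime `p ≥ 5` (indeed `binom(p-1,2) = p·(p-3)/2 + 1`). [folklore] -/
theorem choose_pred_two_modEq_one (p : ℕ) [hp : Fact p.Prime] (hp5 : 5 ≤ p) : (p - 1).choose 2 ≡ 1 [MOD p] := by
  obtain ⟨q, hq⟩ : ∃ q, p = 2 * q + 1 := hp.out.odd_of_ne_two (by omega)
  have h1 : (p - 1).choose 2 = p * (q - 1) + 1 := by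
    rw [Nat.choose_two_right]
    subst hq
    obtain ⟨r, rfl⟩ : ∃ r, q = r + 2 := ⟨q - 2, by omega⟩
    have e1 : 2 * (r + 2) + 1 - 1 = 2 * (r + 2) := by omega
    have e2 : 2 * (r + 2) - 1 = 2 * r + 3 := by omega
    rw [e1, e2, show 2 * (r + 2) * (2 * r + 3) = 2 * ((r + 2) * (2 * r + 3)) by ring,
      Nat.mul_div_cancel_left _ (by norm_num : 0 < 2), show r + 2 - 1 = r + 1 by omega]
    ring
  rw [h1, Nat.ModEq, Nat.add_mod, Nat.mul_mod_right, zero_add, Nat.mod_mod]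

variable (K : Type*) [Field K] (p : ℕ) [Fact p.Prime] [CharP K p]

/-- `¬ CA_{p-1}` over every field of characteristic `p ≥ 5` (witness `X^(p-1) - X^2`). [folklore] -/
theorem not_holdsInDegree_pred_of_charP (hp5 : 5 ≤ p) : ¬ HoldsInDegree K (p - 1) :=
  not_holdsInDegree_of_choose_modEq_one K p (m := 2) (by norm_num) (by omega) (choose_pred_two_modEq_one p hp5)

/-- `¬ CA_{(p-1)·p^k}` over every field of characteristic `p ≥ 5`: the top base-`p` digit is never a Casas-Alvero digit.
[folklore] -/
theorem not_holdsInDegree_pred_mul_prime_pow (hp5 : 5 ≤ p) (k : ℕ) : ¬ HoldsInDegree K ((p - 1) * p ^ k) :=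
  not_holdsInDegree_mul_prime_pow p k (not_holdsInDegree_pred_of_charP K p hp5)

/-- consequently, in every characteristic `p ≥ 5` the Casas-Alvero property fails in infinitely many "digit" degrees
`a·p^k` with `a < p` — the digit criterion is never the whole story. [folklore] -/
theorem exists_digit_not_holdsInDegree (hp5 : 5 ≤ p) (k : ℕ) :
    ∃ a, 0 < a ∧ a < p ∧ ¬ HoldsInDegree K (a * p ^ k) :=
  ⟨p - 1, by omega, by omega, not_holdsInDegree_pred_mul_prime_pow K p hp5 k⟩

end Literature.Algebra.Polynomial.CasasAlvero
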